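/-
Copyright (c) 2026 the pub-hodgecm-mathlib formalisation cell (harness21).  Prover seat hodgecm-mathlib-K2E1-p11 (g4), Track B ∕ K2-LIT, h413 = `stmt-HodgeConjecture-24833`,
R90-TF section S8 «ContSpec-n½», #2 road (G side), S8 dealer R90-CS-plan (g3) S8-R136 (3) ∕ S8-R151 (1) «NON-ZERO SECTION WITNESS AT A LEVEL», FILE 3c of the census
`R90/S8/CENSUS-ChiSectionPairArchSection.K2E1-p11-g4.md` 3c6bbbb28138e070: ASSEMBLY — the archimedean `ℓ`-section `Φa = Θ(ℓ)·ρ_ℓ·χ₂⟨det⟩` (★ p863618 ED.2) pays the letters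
`hΦac` (★ FILE 3b), `hΦaB` (this file, from ★ FILE 3a's multiplier lemma) and `hΦa1` (`Φa(1) = 1`) of ★ p863433's GLUE; with ★ p863484's finite level section this yields
**THE WITNESS `∃ K′ ω φ, φ ∈ chiSectionSpacePair χ₁ χ₂ K′ ω ∧ Continuous φ ∧ φ 1 ≠ 0`** at any open finite level `K_f` on which the Borel pair character dies.
-/
import Summits.HodgeConjecture.HodgeConjecture.Theorems.R90S8ChiSectionPairArchSectionContinuityU3   -- ★ (this seat) FILE 3b: `continuous_archSectionL`, `norm_archLastRow_fst_ne_zero`; brings ★ 3a, Defs, FILE 2, FILE 1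
import HarnessLib

/-!
# S8 #2 road (G side) — `R90S8ChiSectionPairArchSectionWitnessU3`: `Φa(b_∞·a) = [χ₁χ₂](b_∞)·Φa(a)`, `Φa(1) = 1`, and THE NON-ZERO `(χ₁,χ₂)`-SECTION AT A LEVEL

WHAT THIS FILE DOES (vocabulary: ★ `archSectionL` = `Φa`, ★ `archPart`, ★ `borelAdelic`, ★ `firstEntryUnit` ∕ `middleEntryUnitary`, ★ `chiSectionSpacePair`).
* §1 `archLastRow_archPart_mul` ∕ `archLastRowL_archPart_mul` (`ℓ(b_∞ a) = (b_∞)₂₂·ℓ(a)`, ★ `lastRow_borel_mul`), `archRowFactorL_archPart_mul` (`ρ_ℓ(b_∞ a) = ρ_ℓ(a)`: numerator and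
  denominator both scale by `‖((b_∞)₂₂)_w‖ ≠ 0`), **`archSectionL_archPart_mul`**: `Φa(b_∞·a) = χ₁((b_∞)₀₀)·χ₂((b_∞)₁₁)·Φa(a)` (★ `lastRowChar_borel_mul_mul_adelicDet` with `y := ℓ(a)`).
* §2 `archLastRowL_one` (`ℓ(1) = 1`), `archRowFactorL_one` (`ρ_ℓ(1) = 1`), **`archSectionL_one`** (`Φa(1) = 1`).
* §3 **`exists_chiSectionPair_continuous_apply_one_ne_zero_of_level`** — THE WITNESS: for unitary `χ₁`, `|χ₂| = 1` and an open `K_f ≤ G(𝔸_f)` with `χ₁(k₀₀)χ₂(k₁₁) = 1` on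
  `K_f ∩ B`, `∃ K′ ω φ, φ ∈ chiSectionSpacePair χ₁ χ₂ K′ ω ∧ Continuous φ ∧ φ 1 ≠ 0` (★ p863433 GLUE ∘ ★ p863484 finite level section ∘ §1–§2 ∘ ★ 3b).
HONEST LABEL: HC_CM is proved only modulo the 7 printed citations (2 remaining named inputs: hLiu418 = `stmt-HodgeConjecture-24832`, h413 = `stmt-HodgeConjecture-24833`) until rung 0
closes; REL ≠ ★ ≠ BUILT; this file asserts no named fact and closes no socket — the (V) table row (i) consumer reads §3 BY NAME with the level as visible data; count-neutral.

## References
* [BorelJacquet1979] A. Borel, H. Jacquet, *Automorphic forms and automorphic representations*, Corvallis PSPM 33.1 (1979), §4.1.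
* [Rogawski1990] J. D. Rogawski, *Automorphic Representations of Unitary Groups in Three Variables* (1990), §1.9–§1.10.
* [MoeglinWaldspurger1995] C. Mœglin, J.-L. Waldspurger, *Spectral Decomposition and Eisenstein Series* (1995), I.2.17.
-/

set_option autoImplicit false
set_option linter.dupNamespace false  -- the mandated namespace `…HodgeConjecture.HodgeConjecture.R90.S8` (LEAD #1 L1) repeats the summit's segment

noncomputable section

open NumberField IsDedekindDomain Topology
open Literature.NumberTheory.Automorphic Literature.NumberTheory.Automorphic.UnitaryGroup Literature.NumberTheory.GaloisRepresentations AdelicGroupData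
open Literature.NumberTheory.Automorphic.Arthur2013.Leaves.TECR
open Literature.NumberTheory.Automorphic.UnitaryGroup.AdelicCharactersDetQuasiSplit (antidiagonal_over_det_ne_zero)
open Summit.HodgeConjecture.HodgeConjecture.Cruxes.H413.K2E1CharacterEisensteinU2Defs
open Summit.HodgeConjecture.HodgeConjecture.Cruxes.H413.K2E1CharacterEisensteinU3PairDefs
open Summit.HodgeConjecture.HodgeConjecture.Cruxes.H413.K2E1ChiSectionSpaceU3PairDefs

namespace Summit.HodgeConjecture.HodgeConjecture.R90.S8

variable (L : Type) [Field L] [NumberField L] [IsCMField L]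

/-! ## §1 Left Borel translations at `∞` -/

/-- `x_j(b_∞·a) = (b_∞)₂₂ · x_j(a)` (★ `lastRow_borel_mul` for `b_∞ := ι_∞(archPart b) ∈ B(𝔸)`). [cite: BorelJacquet1979, §4.1] -/
theorem archLastRow_archPart_mul {b : (quasiSplit (↥(maximalRealSubfield L)) L (IsCMField.complexConj L) 3).Adelic}
    (hb : b ∈ borelAdelic (↥(maximalRealSubfield L)) L (IsCMField.complexConj L) 3)
    (a : arch (↥(maximalRealSubfield L)) L (IsCMField.complexConj L) 3 ((StdForm.antidiagonal 3).over L)) (j : Fin 3) :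
    archLastRow L (archPart (↥(maximalRealSubfield L)) L (IsCMField.complexConj L) 3 ((StdForm.antidiagonal 3).over L) b * a) j =
      (diagEntryUnit (archToAdelic_archPart_mem_borelAdelic L hb) 2 : AdeleRing (𝓞 L) L) * archLastRow L a j := by
  rw [archLastRow_def, archLastRow_def, map_mul]
  exact lastRow_borel_mul L (archToAdelic_archPart_mem_borelAdelic L hb) _ j

/-- `ℓ(b_∞·a) = (b_∞)₂₂ · ℓ(a)`. [cite: BorelJacquet1979, §4.1] -/
theorem archLastRowL_archPart_mul {b : (quasiSplit (↥(maximalRealSubfield L)) L (IsCMField.complexConj L) 3).Adelic}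
    (hb : b ∈ borelAdelic (↥(maximalRealSubfield L)) L (IsCMField.complexConj L) 3)
    (a : arch (↥(maximalRealSubfield L)) L (IsCMField.complexConj L) 3 ((StdForm.antidiagonal 3).over L)) :
    archLastRowL L (archPart (↥(maximalRealSubfield L)) L (IsCMField.complexConj L) 3 ((StdForm.antidiagonal 3).over L) b * a) =
      (diagEntryUnit (archToAdelic_archPart_mem_borelAdelic L hb) 2 : AdeleRing (𝓞 L) L) * archLastRowL L a := by
  rw [archLastRowL_def, archLastRowL_def, archLastRow_archPart_mul L hb, archLastRow_archPart_mul L hb, mul_sub]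

/-- **`ρ_ℓ(b_∞·a) = ρ_ℓ(a)`**: at each place numerator and denominator scale by `‖((b_∞)₂₂)_w‖ ≠ 0`. [cite: BorelJacquet1979, §4.1] -/
theorem archRowFactorL_archPart_mul {b : (quasiSplit (↥(maximalRealSubfield L)) L (IsCMField.complexConj L) 3).Adelic}
    (hb : b ∈ borelAdelic (↥(maximalRealSubfield L)) L (IsCMField.complexConj L) 3)
    (a : arch (↥(maximalRealSubfield L)) L (IsCMField.complexConj L) 3 ((StdForm.antidiagonal 3).over L)) :
    archRowFactorL L (archPart (↥(maximalRealSubfield L)) L (IsCMField.complexConj L) 3 ((StdForm.antidiagonal 3).over L) b * a) = archRowFactorL L a := by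
  rw [archRowFactorL_def, archRowFactorL_def]
  refine Finset.prod_congr rfl fun w _ => ?_
  set d : AdeleRing (𝓞 L) L := (diagEntryUnit (archToAdelic_archPart_mem_borelAdelic L hb) 2 : AdeleRing (𝓞 L) L) with hd
  have hd0 : d.1 w ≠ 0 :=
    ((Units.isUnit (diagEntryUnit (archToAdelic_archPart_mem_borelAdelic L hb) 2)).map
      ((Pi.evalRingHom (fun v : InfinitePlace L => v.Completion) w).comp (adeleFst L))).ne_zero
  have h1 : (archLastRowL L (archPart (↥(maximalRealSubfield L)) L (IsCMField.complexConj L) 3 ((StdForm.antidiagonal 3).over L) b * a)).1 w =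
      d.1 w * (archLastRowL L a).1 w := by
    rw [archLastRowL_archPart_mul L hb]
    rfl
  have h2 : (fun j : Fin 3 => (archLastRow L (archPart (↥(maximalRealSubfield L)) L (IsCMField.complexConj L) 3 ((StdForm.antidiagonal 3).over L) b * a) j).1 w) =
      d.1 w • fun j : Fin 3 => (archLastRow L a j).1 w := by
    funext j
    rw [Pi.smul_apply, smul_eq_mul, archLastRow_archPart_mul L hb]
    rfl
  rw [h1, h2, norm_mul, norm_smul, mul_div_mul_left _ _ (norm_ne_zero_iff.2 hd0)]

/-- **`Φa(b_∞·a) = χ₁((b_∞)₀₀)·χ₂((b_∞)₁₁)·Φa(a)`** — the letter `hΦaB` of ★ p863433 with `ca := [χ₁χ₂](·_∞)` (★ `lastRowChar_borel_mul_mul_adelicDet` with `y := ℓ(a)`, §1).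
[cite: Rogawski1990, §1.10] [cite: BorelJacquet1979, §4.1] -/
theorem archSectionL_archPart_mul (χ₁ : HeckeCharacter L) (χ₂ : ↥(TorusDict.torus (IsCMField.complexConj L)) →ₜ* ℂˣ)
    {b : (quasiSplit (↥(maximalRealSubfield L)) L (IsCMField.complexConj L) 3).Adelic} (hb : b ∈ borelAdelic (↥(maximalRealSubfield L)) L (IsCMField.complexConj L) 3)
    (a : arch (↥(maximalRealSubfield L)) L (IsCMField.complexConj L) 3 ((StdForm.antidiagonal 3).over L)) :
    archSectionL L χ₁ χ₂ (archPart (↥(maximalRealSubfield L)) L (IsCMField.complexConj L) 3 ((StdForm.antidiagonal 3).over L) b * a) =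
      (((χ₁ (firstEntryUnit (archToAdelic_archPart_mem_borelAdelic L hb)) : ℂˣ) : ℂ) * ((χ₂ (middleEntryUnitary (archToAdelic_archPart_mem_borelAdelic L hb)) : ℂˣ) : ℂ)) *
        archSectionL L χ₁ χ₂ a := by
  have key := lastRowChar_borel_mul_mul_adelicDet L χ₁ χ₂ (archToAdelic_archPart_mem_borelAdelic L hb)
    (archToAdelic (↥(maximalRealSubfield L)) L (IsCMField.complexConj L) 3 ((StdForm.antidiagonal 3).over L) a) (archLastRowL L a)
  rw [← map_mul] at key
  rw [archSectionL_def, archSectionL_def, archLastRowL_archPart_mul L hb, archRowFactorL_archPart_mul L hb, mul_right_comm, key]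
  ring

/-! ## §2 The value at `1` -/

/-- `x_j(1) = δ_{2j}`. [folklore] -/
theorem archLastRow_one (j : Fin 3) : archLastRow L 1 j = (1 : Matrix (Fin 3) (Fin 3) (AdeleRing (𝓞 L) L)) 2 j := by
  rw [archLastRow_def, map_one, map_one, Units.val_one]

/-- `ℓ(1) = 1 − 0 = 1`. [folklore] -/
theorem archLastRowL_one : archLastRowL L 1 = 1 := by
  rw [archLastRowL_def, archLastRow_one, archLastRow_one, Matrix.one_apply_eq, Matrix.one_apply_ne (by decide), sub_zero]

/-- At `a = 1` every archimedean row is `(0, 0, 1)`, of sup-norm `1`. [folklore] -/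
theorem norm_archLastRow_one_fst (w : InfinitePlace L) : ‖fun j : Fin 3 => (archLastRow L 1 j).1 w‖ = 1 := by
  have h2 : (archLastRow L 1 2).1 w = 1 := by
    rw [archLastRow_one, Matrix.one_apply_eq]
    rfl
  have hj : ∀ j : Fin 3, j ≠ 2 → (archLastRow L 1 j).1 w = 0 := fun j hj => by
    rw [archLastRow_one, Matrix.one_apply_ne (Ne.symm hj)]
    rfl
  refine le_antisymm ((pi_norm_le_iff_of_nonneg zero_le_one).2 fun j => ?_) ?_
  · show ‖(archLastRow L 1 j).1 w‖ ≤ 1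
    by_cases hj2 : j = 2
    · rw [hj2, h2, norm_one]
    · rw [hj j hj2, norm_zero]
      exact zero_le_one
  · have h := norm_le_pi_norm (fun j : Fin 3 => (archLastRow L 1 j).1 w) 2
    rwa [h2, norm_one] at h

/-- `ρ_ℓ(1) = 1`. [folklore] -/
theorem archRowFactorL_one : archRowFactorL L 1 = 1 := by
  rw [archRowFactorL_def]
  refine Finset.prod_eq_one fun w _ => ?_
  rw [norm_archLastRow_one_fst, archLastRowL_one, div_one]
  show ‖(1 : w.Completion)‖ = 1
  exact norm_one

/-- **`Φa(1) = 1`** — the letter `hΦa1` of ★ p863433 (`Θ(1) = 1` ★ `lastRowChar_one`, `ρ_ℓ(1) = 1`, `χ₂⟨det 1⟩ = 1`). [folklore] -/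
theorem archSectionL_one (χ₁ : HeckeCharacter L) (χ₂ : ↥(TorusDict.torus (IsCMField.complexConj L)) →ₜ* ℂˣ) : archSectionL L χ₁ χ₂ 1 = 1 := by
  have h1 : archToAdelic (↥(maximalRealSubfield L)) L (IsCMField.complexConj L) 3 ((StdForm.antidiagonal 3).over L) 1 = 1 := map_one _
  have h2 : adelicDet (↥(maximalRealSubfield L)) L (IsCMField.complexConj L) 3 ((StdForm.antidiagonal 3).over L) (antidiagonal_over_det_ne_zero L 3)
      (archToAdelic (↥(maximalRealSubfield L)) L (IsCMField.complexConj L) 3 ((StdForm.antidiagonal 3).over L) 1) = 1 := by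
    rw [h1]
    exact map_one _
  rw [archSectionL_def, archLastRowL_one, lastRowChar_one, archRowFactorL_one, h2, map_one, Units.val_one, Complex.ofReal_one, mul_one, mul_one]

/-! ## §3 THE WITNESS at a level -/

/-- **THE NON-ZERO `(χ₁,χ₂)`-SECTION AT A LEVEL** ((V) discharge-table row (i), S8-R136 (3)).  For a unitary Hecke character `χ₁` of `L`, a character `χ₂` of `T = U(1)(𝔸_{L⁺})` with
`|χ₂| = 1`, and an open subgroup `K_f ≤ G(𝔸_f)` on whose Borel elements the pair character `χ₁(k₀₀)χ₂(k₁₁)` is trivial, **there are a subgroup `K′ ≤ G(𝔸)`, `ω : K′ →* ℂ` and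
`φ ∈ chiSectionSpacePair χ₁ χ₂ K′ ω`, continuous, with `φ(1) ≠ 0`** — namely `K′ = ι_f(K_f)`, `ω = 1`, `φ(g) = Φa(g_∞)·Φf(g_f)` with the archimedean `ℓ`-section `Φa = Θ(ℓ)·ρ_ℓ·χ₂⟨det⟩`
(★ ED.2; continuity ★ 3b from unitarity, equivariance §1, `Φa(1) = 1` §2) and ★ p863484's finite level section `Φf` (`Φf(1) = 1`), glued by ★ p863433.
[cite: BorelJacquet1979, §4.1] [cite: MoeglinWaldspurger1995, I.2.17] [cite: Rogawski1990, §1.10] -/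
theorem exists_chiSectionPair_continuous_apply_one_ne_zero_of_level (χ₁ : HeckeCharacter L) (χ₂ : ↥(TorusDict.torus (IsCMField.complexConj L)) →ₜ* ℂˣ)
    (hχ₁u : χ₁.IsUnitary) (hχ₂u : ∀ u, ‖((χ₂ u : ℂˣ) : ℂ)‖ = 1)
    (Kf : Subgroup ↥(finAdelic (↥(maximalRealSubfield L)) L (IsCMField.complexConj L) 3 ((StdForm.antidiagonal 3).over L)))
    (hKo : IsOpen ((Kf : Subgroup ↥(finAdelic (↥(maximalRealSubfield L)) L (IsCMField.complexConj L) 3 ((StdForm.antidiagonal 3).over L))) :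
      Set ↥(finAdelic (↥(maximalRealSubfield L)) L (IsCMField.complexConj L) 3 ((StdForm.antidiagonal 3).over L))))
    (hKχ : ∀ k ∈ Kf, ∀ (hk : finAdelicToAdelic (↥(maximalRealSubfield L)) L (IsCMField.complexConj L) 3 ((StdForm.antidiagonal 3).over L) k ∈
        borelAdelic (↥(maximalRealSubfield L)) L (IsCMField.complexConj L) 3),
      ((χ₁ (firstEntryUnit hk) : ℂˣ) : ℂ) * ((χ₂ (middleEntryUnitary hk) : ℂˣ) : ℂ) = 1) :
    ∃ (K' : Subgroup (quasiSplit (↥(maximalRealSubfield L)) L (IsCMField.complexConj L) 3).Adelic) (ω : ↥K' →* ℂ)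
      (φ : (quasiSplit (↥(maximalRealSubfield L)) L (IsCMField.complexConj L) 3).Adelic → ℂ),
      φ ∈ chiSectionSpacePair χ₁ χ₂ K' (ω : ↥K' → ℂ) ∧ Continuous φ ∧ φ 1 ≠ 0 := by
  classical
  obtain ⟨Φf, hΦfc, hΦfB, hΦfK, hΦf1⟩ := exists_finLevelSection L χ₁ χ₂ Kf hKo hKχ
  refine exists_chiSectionPair_continuous_apply_one_ne_zero_of_letters L
    (fun b => if hb : b ∈ borelAdelic (↥(maximalRealSubfield L)) L (IsCMField.complexConj L) 3 then
      ((χ₁ (firstEntryUnit (archToAdelic_archPart_mem_borelAdelic L hb)) : ℂˣ) : ℂ) * ((χ₂ (middleEntryUnitary (archToAdelic_archPart_mem_borelAdelic L hb)) : ℂˣ) : ℂ)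
      else 0)
    (fun b => if hb : b ∈ borelAdelic (↥(maximalRealSubfield L)) L (IsCMField.complexConj L) 3 then
      ((χ₁ (firstEntryUnit (finAdelicToAdelic_finPart_mem_borelAdelic L hb)) : ℂˣ) : ℂ) * ((χ₂ (middleEntryUnitary (finAdelicToAdelic_finPart_mem_borelAdelic L hb)) : ℂˣ) : ℂ)
      else 0)
    (archSectionL L χ₁ χ₂) Φf Kf (fun b hb => ?_) (continuous_archSectionL L χ₁ χ₂ hχ₁u hχ₂u) (fun b hb a => ?_) ?_ hΦfc (fun b hb u => ?_) hΦfK ?_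
  · simp only [dif_pos hb]
    exact (borelPairChar_eq_arch_mul_fin L χ₁ χ₂ hb).symm
  · simp only [dif_pos hb]
    exact archSectionL_archPart_mul L χ₁ χ₂ hb a
  · rw [archSectionL_one]
    exact one_ne_zero
  · simp only [dif_pos hb]
    exact hΦfB b hb u
  · rw [hΦf1]
    exact one_ne_zero

end Summit.HodgeConjecture.HodgeConjecture.R90.S8

end
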